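import Literature.NumberTheory.Automorphic.AshSmithTheoryHeckeDoubleCosetProofs
import Literature.NumberTheory.GaloisRepresentations.HeckeCharacterProofs
import HarnessLib

/-!
# Ash (2003), *Smith theory and Hecke operators* — proofs towards the named fact
# `Ash2003_inducedRayClassCharacter_attached`: Theorem 1.1 for the characters `θ = χ ∘ N_{L/ℚ}`

Topic `NumberTheory/Automorphic`; companion of `Literature.NumberTheory.Automorphic.AshSmithTheoryHecke`
(the named fact `Ash2003_inducedRayClassCharacter_attached` = A. Ash, *Smith theory and Hecke
operators*, J. Algebra **259** (2003) 43–58 [Ash2003], Thm. 1.1 / Cor. 4.4: for every mod-`p` ray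
class character `θ` of `L = ℚ(ζ_p)` modulo `(pN)`, `Ind θ` is attached to a Hecke eigenclass in
`H^*(X(pN), F)`).  `AshSmithTheoryHeckeDoubleCosetProofs` settled the trivial character; this file
settles **every `θ` that factors through the norm**, `θ = χ ∘ N_{L/ℚ}` for a Dirichlet character
`χ` mod `pN` with values in `F` — exactly the characters whose eigenclass in [Ash2003] lives in
degree `0` (the remaining ones are the Smith-theory content of the paper, §§2–6):

* `Ash2003.exists_isEigenclass_isAttached_of_isGaloisAvatar_of_norm`: for a prime `p`, `N ≥ 1`, a
  field `F` of characteristic `p`, `χ : (ℤ/pN) → F` a Dirichlet character, `θ` a character of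
  `Cl^{(pN)}(ℚ(ζ_p))` with `θ([w]) = χ(N w)` at the primes `w ∤ pN`, and a Galois avatar `ϑ` of `θ`,
  there are `i` (`= 0`), a Hecke eigenclass `α ∈ H^i(X(pN), F)` and eigenvalues `a` with
  `Ash2003.IsEigenclass … α a ∧ Ash2003.IsAttached p (pN) (Ind ϑ) a` — the conclusion of the fact;
* `Ash2003.exists_isEigenclass_isAttached_induce_one`: the case `θ = 𝟙` with the avatar `ϑ = 𝟙`
  supplied (`isGaloisAvatar_one_one`), i.e. unconditionally `Ind 𝟙` is attached to `[1] ∈ H⁰`.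

Ingredients, in order:

* (general arithmetic quotients, namespace `ArithmeticQuotient`) `charFun_mk`,
  `charFun_mem_invariants`, `heckeFun_charFun`: a character `φ : 𝒢 → k^×` trivial on the level `L`
  and on `ι(Γ)` is a `Γ`-invariant function on `𝒢 ⧸ L` on which `[L g L]` acts by
  `#(LgL/L) · φ(g)`; `heckeEnd_H0Iso_inv_eq_smul` transports eigenfunctions to eigenclasses in
  `H⁰(X_L, k)` (Mathlib `groupCohomology.H0Iso`; generalises `heckeEnd_H0Iso_inv_constOne`);
* `Ash2003.valued_det_sub_one_le`: `|det g - 1| ≤ c` for an integral matrix `g ≡ 1` up to radius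
  `c` over a valued field (Leibniz expansion);
* the determinant character `g ↦ η(det (1, g) mod M)` of `GL_n(𝔸_ℚ^∞)` (`(1, g) = GLn.ofFinite g`),
  through the tree's ray class map `Rat.rayClassHom M : 𝕀_ℚ → (ℤ/M)^×` (`HeckeCharacterProofs`,
  [NeukirchANT1999, Ch. VI Prop. (1.10)]): it is trivial on `K_f(M)`
  (`rayClassHom_det_ofFinite_eq_one`: `det K_f(M)` is `≡ 1 mod M` in `ẑ^×`) and on `GL_n(ℚ)⁺`
  (`rayClassHom_det_ofFinite_toFiniteAdelic`: positive rational determinants), and takes the value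
  `η(l mod M)^{-k}` on `s_{l,k}` (`rayClassHom_det_ofFinite_heckeElement`, from
  `Rat.rayClassHom_localUnits_primeLocalUnit`);
* `Ash2003.exists_isEigenclass_zero_detCharacter`: hence `[η ∘ det] ∈ H⁰(X(M), F)` is a Hecke
  eigenclass with `T_{l,k}`-eigenvalue `#(K_f s_{l,k} K_f/K_f) · η(l)^{-k}`;
* `Ash2003.heckeFrobPoly_card_doubleCosetQuot_mul_pow`: the Hecke–Frobenius polynomial of these
  eigenvalues is `∏_{j<n} (X - η(l)^{-1} l^j)` (Gauss's identity
  `sum_ncard_orbit_heckeDiag_mul_pow_eq_prod` of `HeckeSeriesCosetCount` at `x = cX`, reversed by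
  `heckeFrobPoly_eq_prod_of_sum_eq`);
* `Ash2003.hasFrobCharpolyAt_induce_of_isGaloisAvatar_of_norm`: on the Galois side
  `det(X - Ind(ϑ)(Frob_l)) = ∏_{j<p-1} (X - χ(l) l^j)` for `θ = χ ∘ N` ([Ash2003, Lemma 4.2] via
  `hasFrobCharpolyAt_induce_of_isGaloisAvatar`, `N w = l^{f(w|l)}`
  (`GaloisRepresentations.residueCard_eq_residueCard_pow_inertiaDeg` of `FrobeniusPlaces`) and
  `prod_range_X_sub_C_mul_pow_eq`); the theorem follows with `η = χ⁻¹`.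

## References

* A. Ash, *Smith theory and Hecke operators*, J. Algebra 259 (2003) 43–58, Thm. 1.1, §2, Def. 0.1,
  Lemma 4.2 [Ash2003].
* J. Neukirch, *Algebraic Number Theory* (1999), Ch. VI §1, Prop. (1.10) (`C_ℚ/C_ℚ^𝔪 ≅ (ℤ/m)^×`)
  [NeukirchANT1999].
* G. Shimura, *Introduction to the arithmetic theory of automorphic functions* (1971), Ch. 3 §3.2
  (degrees of the `T_k`, the `q`-binomial identity) [ShimuraIATAF1971].
-/

noncomputable section

open scoped NumberField
open IsDedekindDomain Polynomial MulAction CategoryTheory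

universe u

namespace Literature.NumberTheory.Automorphic

/-! ### Degree-`0` eigenclasses from characters of `𝒢` (general arithmetic quotients) -/

namespace ArithmeticQuotient

variable (k : Type u) [CommRing k] {Γ 𝒢 : Type u} [Group Γ] [Group 𝒢] (ι : Γ →* 𝒢)
  (L : Subgroup 𝒢)

variable {L} in
/-- The function `gL ↦ φ((gL).out)` on `𝒢 ⧸ L` attached to a character `φ : 𝒢 →* kˣ` trivial on `L`
is `gL ↦ φ(g)`. [folklore] -/
theorem charFun_mk {φ : 𝒢 →* kˣ} (hL : ∀ l ∈ L, φ l = 1) (g : 𝒢) :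
    ((φ (g : 𝒢 ⧸ L).out : kˣ) : k) = φ g := by
  obtain ⟨l, hl⟩ := QuotientGroup.mk_out_eq_mul L g
  rw [hl, map_mul, hL l l.2, mul_one]

variable {L} in
/-- A character of `𝒢` trivial on `L` and on `ι(Γ)` gives a `Γ`-invariant function on `𝒢 ⧸ L`, i.e.
an element of `H⁰(X_L, k) = Fun(𝒢 ⧸ L, k)^Γ` (a function on the component set `Γ \ 𝒢 / L`).
[folklore] -/
theorem charFun_mem_invariants {φ : 𝒢 →* kˣ} (hL : ∀ l ∈ L, φ l = 1) (hΓ : ∀ γ, φ (ι γ) = 1) :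
    (fun c : 𝒢 ⧸ L => ((φ c.out : kˣ) : k)) ∈ (coeffRepresentation k ι L k).invariants := by
  intro γ
  funext c
  induction c using QuotientGroup.induction_on with
  | H x =>
    change ((φ ((ι γ)⁻¹ • (x : 𝒢 ⧸ L)).out : kˣ) : k) = ((φ (x : 𝒢 ⧸ L).out : kˣ) : k)
    rw [MulAction.Quotient.smul_coe, smul_eq_mul, charFun_mk k hL, charFun_mk k hL, map_mul,
      map_inv, hΓ, inv_one, one_mul]

variable {L} in
open scoped Classical in
/-- **`T_g (φ) = #(L g L / L) φ(g) · φ`**: the Hecke operator `[L g L]` acts on the function `gL ↦ φ(g)`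
of a character `φ` trivial on `L` by the scalar `#(LgL/L) · φ(g)` (every single coset `hL ⊆ LgL`
has `φ(h) = φ(g)`). [folklore] -/
theorem heckeFun_charFun {φ : 𝒢 →* kˣ} (hL : ∀ l ∈ L, φ l = 1) {g : 𝒢}
    (hfin : (doubleCosetQuot L g).Finite) :
    heckeFun k L g k (fun c : 𝒢 ⧸ L => ((φ c.out : kˣ) : k)) =
      ((hfin.toFinset.card : k) * φ g) • fun c : 𝒢 ⧸ L => ((φ c.out : kˣ) : k) := by
  funext c
  rw [heckeFun_apply, dif_pos hfin, Pi.smul_apply, smul_eq_mul]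
  have hterm : ∀ d ∈ hfin.toFinset, ((φ (c.out • d).out : kˣ) : k) = (φ g : k) * (φ c.out : k) := by
    intro d hd
    rw [Set.Finite.mem_toFinset] at hd
    obtain ⟨l, rfl⟩ := MulAction.mem_orbit_iff.1 hd
    change ((φ ((c.out * ((l : 𝒢) * g) : 𝒢) : 𝒢 ⧸ L).out : kˣ) : k) = (φ g : k) * (φ c.out : k)
    rw [charFun_mk k hL, map_mul, map_mul, hL l l.2, one_mul, Units.val_mul, mul_comm]
  rw [Finset.sum_congr rfl hterm, Finset.sum_const, nsmul_eq_mul, mul_assoc]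

/-- **Eigenfunctions give eigenclasses in `H⁰`**: if `T_g f = c · f` on an invariant function `f`, then
the class of `f` in `H⁰(X_L, k)` (Mathlib `groupCohomology.H0Iso`) satisfies `T_g [f] = c · [f]`
(naturality of `H0Iso`, `groupCohomology.map_id_comp_H0Iso_hom`; the case `f = 1` is
`heckeEnd_H0Iso_inv_constOne`). [folklore] -/
theorem heckeEnd_H0Iso_inv_eq_smul (f : (coeffRepresentation k ι L k).invariants) {g : 𝒢} {c : k}
    (h : heckeFun k L g k (f : (𝒢 ⧸ L) → k) = c • (f : (𝒢 ⧸ L) → k)) :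
    heckeEnd k L g k ι 0 ((groupCohomology.H0Iso (coeffRep k ι L k)).inv f) =
      c • (groupCohomology.H0Iso (coeffRep k ι L k)).inv f := by
  set A := coeffRep k ι L k with hA
  set e := groupCohomology.H0Iso A with he
  have hx : (Rep.invariantsFunctor k Γ).map (heckeRepHom k L g k ι) f = c • f := by
    apply Subtype.ext
    change heckeFun k L g k (f : (𝒢 ⧸ L) → k) = c • (f : (𝒢 ⧸ L) → k)
    exact h
  have hnat := groupCohomology.map_id_comp_H0Iso_hom (heckeRepHom k L g k ι)
  have h1 : e.hom (groupCohomology.map (MonoidHom.id Γ) (heckeRepHom k L g k ι) 0 (e.inv f)) =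
      c • f := by
    have h2 := ConcreteCategory.congr_hom hnat (e.inv f)
    rw [ConcreteCategory.comp_apply, ConcreteCategory.comp_apply] at h2
    rw [h2]
    change (Rep.invariantsFunctor k Γ).map (heckeRepHom k L g k ι) (e.hom (e.inv f)) = _
    rw [Iso.inv_hom_id_apply, hx]
  have h3 := congrArg e.inv h1
  rw [Iso.hom_inv_id_apply, map_smul] at h3
  exact h3

/-- The class in `H⁰(X_L, k)` of an invariant function with a nonzero value is nonzero. [folklore] -/
theorem H0Iso_inv_ne_zero_of_apply_ne_zero (f : (coeffRepresentation k ι L k).invariants)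
    {c : 𝒢 ⧸ L} (hf : (f : (𝒢 ⧸ L) → k) c ≠ 0) :
    (groupCohomology.H0Iso (coeffRep k ι L k)).inv f ≠ 0 := by
  intro h
  have h1 := congrArg (groupCohomology.H0Iso (coeffRep k ι L k)).hom h
  rw [Iso.inv_hom_id_apply, map_zero] at h1
  apply hf
  rw [h1]
  rfl

end ArithmeticQuotient

/-! ### Determinants of matrices congruent to `1` over a valued field -/

namespace Ash2003

open GaloisRepresentations

section ValuedDet

variable {K Γ₀ : Type*} [Field K] [LinearOrderedCommGroupWithZero Γ₀] [Valued K Γ₀]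
  {m : Type*} [Fintype m] [DecidableEq m]

/-- A matrix with integral entries has integral determinant (Leibniz expansion). [folklore] -/
theorem valued_det_le_one {M : Matrix m m K} (hM : ∀ i j, Valued.v (M i j) ≤ 1) :
    Valued.v M.det ≤ 1 := by
  rw [Matrix.det_apply]
  refine Valued.v.map_sum_le fun σ _ => ?_
  rw [Units.smul_def, zsmul_eq_mul, map_mul]
  refine mul_le_one' ?_ ?_
  · rcases Int.units_eq_one_or (Equiv.Perm.sign σ) with h | h <;> simp [h]
  · rw [map_prod]
    exact Finset.prod_le_one' fun i _ => hM _ _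

/-- Elements of `GL_m(𝒪)` (entries of `g` and `g⁻¹` integral) have unit determinant. [folklore] -/
theorem valued_det_eq_one {g : GL m K}
    (h₁ : ∀ i j, Valued.v ((g : Matrix m m K) i j) ≤ 1)
    (h₂ : ∀ i j, Valued.v (((g⁻¹ : GL m K) : Matrix m m K) i j) ≤ 1) :
    Valued.v ((Matrix.GeneralLinearGroup.det g : Kˣ) : K) = 1 := by
  have hle : Valued.v ((Matrix.GeneralLinearGroup.det g : Kˣ) : K) ≤ 1 := valued_det_le_one h₁
  have hle' : Valued.v ((Matrix.GeneralLinearGroup.det g⁻¹ : Kˣ) : K) ≤ 1 := valued_det_le_one h₂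
  have hmul : Valued.v ((Matrix.GeneralLinearGroup.det g : Kˣ) : K) *
      Valued.v ((Matrix.GeneralLinearGroup.det g⁻¹ : Kˣ) : K) = 1 := by
    rw [← map_mul, ← Units.val_mul, ← map_mul, mul_inv_cancel, map_one, Units.val_one, map_one]
  refine le_antisymm hle ?_
  calc (1 : Γ₀) = Valued.v ((Matrix.GeneralLinearGroup.det g : Kˣ) : K) *
        Valued.v ((Matrix.GeneralLinearGroup.det g⁻¹ : Kˣ) : K) := hmul.symm
    _ ≤ Valued.v ((Matrix.GeneralLinearGroup.det g : Kˣ) : K) * 1 := by gcongr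
    _ = _ := mul_one _

/-- **`det M ≡ 1`**: if `M` has integral entries and `M ≡ 1` entrywise up to radius `c`
(`|(M - 1)_{ij}| ≤ c`), then `|det M - 1| ≤ c` — in the Leibniz expansion the diagonal term is
`∏ (1 + d_i) ≡ 1` and every other term contains an off-diagonal entry. [folklore] -/
theorem valued_det_sub_one_le {M : Matrix m m K} {c : Γ₀}
    (h1 : ∀ i j, Valued.v (M i j) ≤ 1) (h2 : ∀ i j, Valued.v ((M - 1) i j) ≤ c) :
    Valued.v (M.det - 1) ≤ c := by
  classical
  -- the diagonal term
  have hdiag : ∀ s : Finset m, Valued.v (∏ i ∈ s, M i i - 1) ≤ c := by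
    intro s
    induction s using Finset.induction_on with
    | empty => simp
    | insert a s ha ih =>
      rw [Finset.prod_insert ha]
      have e : M a a * ∏ i ∈ s, M i i - 1 =
          (M a a - 1) * ∏ i ∈ s, M i i + (∏ i ∈ s, M i i - 1) := by ring
      rw [e]
      refine Valuation.map_add_le _ ?_ ih
      rw [map_mul]
      have ha1 : Valued.v (M a a - 1) ≤ c := by
        have := h2 a a
        rwa [Matrix.sub_apply, Matrix.one_apply_eq] at this
      have hP : Valued.v (∏ i ∈ s, M i i) ≤ 1 := by
        rw [map_prod]
        exact Finset.prod_le_one' fun i _ => h1 i i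
      calc Valued.v (M a a - 1) * Valued.v (∏ i ∈ s, M i i) ≤ c * 1 := mul_le_mul' ha1 hP
        _ = c := mul_one c
  -- the other terms
  have hoff : ∀ σ : Equiv.Perm m, σ ≠ 1 →
      Valued.v (Equiv.Perm.sign σ • ∏ i, M (σ i) i) ≤ c := by
    intro σ hσ
    obtain ⟨i, hi⟩ : ∃ i, σ i ≠ i := by
      by_contra! h
      exact hσ (Equiv.ext h)
    rw [Units.smul_def, zsmul_eq_mul, map_mul]
    have hs : Valued.v (((Equiv.Perm.sign σ : ℤˣ) : ℤ) : K) ≤ 1 := by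
      rcases Int.units_eq_one_or (Equiv.Perm.sign σ) with h | h <;> simp [h]
    have hprod : Valued.v (∏ j, M (σ j) j) ≤ c := by
      rw [map_prod, ← Finset.mul_prod_erase Finset.univ _ (Finset.mem_univ i)]
      have hi' : Valued.v (M (σ i) i) ≤ c := by
        have := h2 (σ i) i
        rwa [Matrix.sub_apply, Matrix.one_apply_ne hi, sub_zero] at this
      calc Valued.v (M (σ i) i) * ∏ j ∈ Finset.univ.erase i, Valued.v (M (σ j) j) ≤ c * 1 :=
            mul_le_mul' hi' (Finset.prod_le_one' fun j _ => h1 _ _)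
        _ = c := mul_one c
    calc Valued.v (((Equiv.Perm.sign σ : ℤˣ) : ℤ) : K) * Valued.v (∏ j, M (σ j) j) ≤ 1 * c :=
          mul_le_mul' hs hprod
      _ = c := one_mul c
  rw [Matrix.det_apply, ← Finset.add_sum_erase Finset.univ _ (Finset.mem_univ (1 : Equiv.Perm m)),
    Equiv.Perm.sign_one, one_smul, add_sub_right_comm]
  refine Valuation.map_add_le _ ?_
    (Valuation.map_sum_le _ fun σ hσ => hoff σ (Finset.ne_of_mem_erase hσ))
  simpa using hdiag Finset.univ

end ValuedDet

/-! ### Theorem 1.1 for `θ = 𝟙` without an avatar hypothesis -/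

/-- The trivial character `𝟙 : Γ_L → F^×` is a Galois avatar of the trivial ray class character
(unramified everywhere, `det(X - 𝟙(Frob_w)) = X - 1`). [folklore] -/
theorem isGaloisAvatar_one_one {L : Type*} [Field L] [NumberField L] {F : Type*} [CommRing F]
    [TopologicalSpace F] {𝔪 : Ideal (𝓞 L)} (h𝔪 : 𝔪 ≠ ⊥) :
    IsGaloisAvatar h𝔪 (1 : GaloisRepresentations.RayClassGroup 𝔪 →* Fˣ)
      (1 : GaloisRepresentations.FramedGaloisRep L F 1) := by
  intro w hw
  refine ⟨fun 𝔓 _ σ _ => by simp, fun 𝔓 _ σ _ => ?_⟩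
  rw [GaloisRepresentations.FramedRep.charpoly, ContinuousMonoidHom.coe_one, Pi.one_apply,
    Units.val_one, Matrix.charpoly_one, Fintype.card_fin, pow_one, MonoidHom.one_apply,
    Units.val_one, map_one]

/-- **[Ash2003, Thm. 1.1] for `θ = 𝟙`, unconditionally**: for a prime `p`, `N ≥ 1` and a field `F`
of characteristic `p`, the representation `Ind_{Γ_{ℚ(ζ_p)}}^{Γ_ℚ} 𝟙` is attached to a Hecke
eigenclass in `H⁰(X(pN), F)` (`exists_isEigenclass_isAttached_of_isGaloisAvatar_one` with the
avatar `ϑ = 𝟙`, `isGaloisAvatar_one_one`). [cite: Ash2003, Thm. 1.1 and Cor. 4.4] -/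
theorem exists_isEigenclass_isAttached_induce_one (p : ℕ) [hp : Fact p.Prime] {N : ℕ}
    (hN : N ≠ 0) (F : Type) [Field F] [Algebra (ZMod p) F] [TopologicalSpace F] :
    ∃ (i : ℕ) (α : cohomology (p - 1) (p * N) F i) (a : HeightOneSpectrum (𝓞 ℚ) → ℕ → F),
      IsEigenclass (p - 1) (p * N) F i α a ∧
        IsAttached p (p * N)
          (GaloisRepresentations.FramedGaloisRep.induce ℚ (finrank_cyclotomicField p)
            (1 : GaloisRepresentations.FramedGaloisRep (CyclotomicField p ℚ) F 1)) a :=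
  exists_isEigenclass_isAttached_of_isGaloisAvatar_one p hN F 1 (isGaloisAvatar_one_one _)

/-! ### Galois side for `θ = χ ∘ N`: `det(X - Ind(ϑ)(Frob_l)) = ∏_{j<p-1} (X - χ(l) l^j)` -/

/-- **`∏_{j<p-1} (X - c l^j) = (X^f - c^f)^g`** over a field of characteristic `p`, for `p ∤ l`,
`f = ord_p(l)`, `f g = p - 1` and any `c`: `l` is a primitive `f`-th root of unity in `F`, so
`X^f - c^f = ∏_{i<f} (X - c l^i)` (Mathlib `X_pow_sub_C_eq_prod`). [folklore] -/
theorem prod_range_X_sub_C_mul_pow_eq (p : ℕ) [hp : Fact p.Prime] {F : Type*} [Field F]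
    [Algebra (ZMod p) F] {ℓ : ℕ} (hℓ : ¬ p ∣ ℓ) {g : ℕ} (hg : orderOf (ℓ : ZMod p) * g = p - 1)
    (c : F) :
    ∏ j ∈ Finset.range (p - 1), (X - C (c * (ℓ : F) ^ j)) =
      (X ^ orderOf (ℓ : ZMod p) - C (c ^ orderOf (ℓ : ZMod p))) ^ g := by
  have hu0 : (ℓ : ZMod p) ≠ 0 := by
    rw [Ne, ZMod.natCast_eq_zero_iff]
    exact hℓ
  have hfin : IsOfFinOrder (ℓ : ZMod p) :=
    isOfFinOrder_iff_pow_eq_one.mpr ⟨p - 1, by have := hp.out.one_lt; omega,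
      ZMod.pow_card_sub_one_eq_one hu0⟩
  have hf0 : 0 < orderOf (ℓ : ZMod p) := hfin.orderOf_pos
  -- `l ∈ F` is a primitive `f`-th root of unity
  have hprim : IsPrimitiveRoot (ℓ : F) (orderOf (ℓ : ZMod p)) := by
    have h := (IsPrimitiveRoot.orderOf (ℓ : ZMod p)).map_of_injective
      (algebraMap (ZMod p) F).injective
    rwa [map_natCast] at h
  have hA : ∏ i ∈ Finset.range (orderOf (ℓ : ZMod p)), (X - C (c * (ℓ : F) ^ i)) =
      X ^ orderOf (ℓ : ZMod p) - C (c ^ orderOf (ℓ : ZMod p)) := by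
    rw [X_pow_sub_C_eq_prod hprim hf0 rfl]
    exact Finset.prod_congr rfl fun i _ => by rw [mul_comm]
  have hB : ∀ g : ℕ, ∏ j ∈ Finset.range (orderOf (ℓ : ZMod p) * g), (X - C (c * (ℓ : F) ^ j)) =
      (X ^ orderOf (ℓ : ZMod p) - C (c ^ orderOf (ℓ : ZMod p))) ^ g := by
    intro g
    induction g with
    | zero => simp
    | succ g ih =>
      rw [Nat.mul_succ, Finset.prod_range_add, ih, pow_succ, ← hA]
      congr 1
      refine Finset.prod_congr rfl fun i _ => ?_
      rw [pow_add, pow_mul, hprim.pow_eq_one, one_pow, one_mul]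
  rw [← hg, hB]

/-- **Galois side of [Ash2003] for `θ = χ ∘ N_{L/ℚ}`**: let `χ` be a Dirichlet character modulo `pN`
with values in a field `F` of characteristic `p`, `θ` a character of `Cl^{(pN)}(ℚ(ζ_p))` with
`θ([w]) = χ(N w)` for the primes `w ∤ pN` of `ℚ(ζ_p)` (i.e. `θ = χ ∘ N_{ℚ(ζ_p)/ℚ}`), and `ϑ` a Galois
avatar of `θ`.  Then at every place `v` with `q_v = l ∤ p · (pN)`,
`det(X - Ind(ϑ)(Frob_v)) = ∏_{j<p-1} (X - χ(l) l^j)` — the polynomial of `χ̃ ⊗ (𝟙 ⊕ ω ⊕ ⋯ ⊕ ω^{p-2})`.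
From `hasFrobCharpolyAt_induce_of_isGaloisAvatar` (`∏_{w ∣ l} (X^{f} - θ([w]))`, [Ash2003, Lemma 4.2]),
`θ([w]) = χ(l^f) = χ(l)^f`, and `prod_range_X_sub_C_mul_pow_eq`. [cite: Ash2003, Lemma 4.2] -/
theorem hasFrobCharpolyAt_induce_of_isGaloisAvatar_of_norm (p : ℕ) [hp : Fact p.Prime] {N : ℕ}
    (hN : N ≠ 0) {F : Type*} [Field F] [Algebra (ZMod p) F] [TopologicalSpace F]
    (χ : MulChar (ZMod (p * N)) F)
    (θ : GaloisRepresentations.RayClassGroup (modulus (CyclotomicField p ℚ) (p * N)) →* Fˣ)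
    (hθ : ∀ (w : HeightOneSpectrum (𝓞 (CyclotomicField p ℚ)))
      (hw : IsCoprime w.asIdeal (modulus (CyclotomicField p ℚ) (p * N))),
      ((θ (GaloisRepresentations.integralRayClass (modulus (CyclotomicField p ℚ) (p * N))
        (modulus_ne_bot (CyclotomicField p ℚ) (mul_ne_zero (Nat.Prime.ne_zero hp.out) hN))
        ⟨w.asIdeal, w.ne_bot, hw⟩) : Fˣ) : F) = χ (w.residueCard : ZMod (p * N)))
    (ϑ : GaloisRepresentations.FramedGaloisRep (CyclotomicField p ℚ) F 1)
    (hϑ : IsGaloisAvatar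
      (modulus_ne_bot (CyclotomicField p ℚ) (mul_ne_zero (Nat.Prime.ne_zero hp.out) hN)) θ ϑ)
    {v : HeightOneSpectrum (𝓞 ℚ)} (hv : ¬ v.residueCard ∣ p * (p * N)) :
    (GaloisRepresentations.FramedGaloisRep.induce ℚ (finrank_cyclotomicField p) ϑ).HasFrobCharpolyAt
      v (∏ j ∈ Finset.range (p - 1),
        (X - C (χ (v.residueCard : ZMod (p * N)) * (v.residueCard : F) ^ j))) := by
  classical
  have h := hasFrobCharpolyAt_induce_of_isGaloisAvatar p hN θ ϑ hϑ hv
  have hpv : ¬ v.residueCard ∣ p := fun h' => hv (h'.trans (Dvd.intro _ rfl))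
  have hpl : ¬ p ∣ v.residueCard := not_dvd_residueCard p hv
  haveI : Fintype {w : HeightOneSpectrum (𝓞 (CyclotomicField p ℚ)) // w.under (𝓞 ℚ) = v} :=
    @Fintype.ofFinite _ (finite_heightOneSpectrum_under_eq v)
  have hfg : orderOf (v.residueCard : ZMod p) *
      Nat.card {w : HeightOneSpectrum (𝓞 (CyclotomicField p ℚ)) // w.under (𝓞 ℚ) = v} = p - 1 := by
    rw [mul_comm]
    exact card_placesOver_mul_orderOf p hpv
  convert h using 2
  rw [finprod_eq_prod_of_fintype, prod_range_X_sub_C_mul_pow_eq p hpl hfg, Nat.card_eq_fintype_card,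
    ← Finset.card_univ, ← Finset.prod_const]
  refine Finset.prod_congr rfl fun w _ => ?_
  have hwv : w.1.asIdeal.under (𝓞 ℚ) = v.asIdeal := congrArg HeightOneSpectrum.asIdeal w.2
  rw [hθ w.1 (isCoprime_modulus_of_under_eq p hv w.2),
    GaloisRepresentations.residueCard_eq_residueCard_pow_inertiaDeg hwv, Nat.cast_pow, map_pow χ,
    inertiaDeg_eq_orderOf p hpv hwv]

end Ash2003


/-! ### Pure algebra: the twisted reversal of the `q`-binomial identity -/

section Reflect

variable {R : Type*} [CommRing R]

/-- `reflect m (∏_{i<m} (1 - d_i X)) = ∏_{i<m} (X - d_i)` for any sequence `d` (the case `d_i = q^i`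
is `reflect_prod_one_sub_C_pow_mul_X`). [folklore] -/
theorem reflect_prod_one_sub_C_mul_X (d : ℕ → R) (m : ℕ) :
    reflect m (∏ i ∈ Finset.range m, (1 - C (d i) * X : R[X])) =
      ∏ i ∈ Finset.range m, (X - C (d i)) := by
  have hdeg1 : ∀ i : ℕ, (1 - C (d i) * X : R[X]).natDegree ≤ 1 := fun i => by
    refine (natDegree_sub_le _ _).trans (max_le (by simp) ?_)
    refine (natDegree_mul_le).trans ?_
    rw [natDegree_C, zero_add]
    exact natDegree_X_le
  induction m with
  | zero => rw [Finset.prod_range_zero, Finset.prod_range_zero, ← C_1, reflect_C, pow_zero, mul_one]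
  | succ m ih =>
    have hdegm : (∏ i ∈ Finset.range m, (1 - C (d i) * X : R[X])).natDegree ≤ m := by
      refine (natDegree_prod_le _ _).trans ?_
      calc ∑ i ∈ Finset.range m, (1 - C (d i) * X : R[X]).natDegree
          ≤ ∑ _i ∈ Finset.range m, 1 := Finset.sum_le_sum fun i _ => hdeg1 i
        _ = m := by simp
    rw [Finset.prod_range_succ, Finset.prod_range_succ, reflect_mul _ _ hdegm (hdeg1 m), ih,
      reflect_one_sub_C_mul_X]

/-- **Reversal**: if `∑_{i ≤ n} (-1)^i q^{i(i-1)/2} b_i X^i = ∏_{i<n} (1 - d_i X)` in `R[X]`, then the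
Hecke–Frobenius polynomial of `b` (tree `heckeFrobPoly`, `∑ (-1)^i q^{i(i-1)/2} b_i X^{n-i}`) is
`∏_{i<n} (X - d_i)` (`Polynomial.reflect n`). [folklore] -/
theorem heckeFrobPoly_eq_prod_of_sum_eq {q n : ℕ} {b : ℕ → R} {d : ℕ → R}
    (h : ∑ i ∈ Finset.range (n + 1), C ((-1 : R) ^ i * (q : R) ^ (i.choose 2) * b i) * X ^ i =
      ∏ i ∈ Finset.range n, (1 - C (d i) * X)) :
    heckeFrobPoly q n b = ∏ i ∈ Finset.range n, (X - C (d i)) := by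
  have href := congrArg (reflect n) h
  rw [reflect_prod_one_sub_C_mul_X, reflect_finset_sum] at href
  rw [← href]
  unfold heckeFrobPoly
  refine Finset.sum_congr rfl fun i hi => ?_
  rw [Finset.mem_range, Nat.lt_succ_iff] at hi
  rw [reflect_C_mul_X_pow, revAt_le hi, Nat.choose_two_right]

end Reflect

namespace Ash2003

open GaloisRepresentations

/-- **The twisted Hecke–Frobenius polynomial of the counts**: for `v ∤ M` (`M ≠ 0`, `l = q_v`), the
numbers `A_k = #(K_f(M) s_{l,k} K_f(M) / K_f(M))` and any scalar `c`,
`∑_{k ≤ n} (-1)^k l^{k(k-1)/2} (A_k c^k) X^{n-k} = ∏_{j<n} (X - c l^j)` — Gauss's identity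
(`sum_ncard_orbit_heckeDiag_mul_pow_eq_prod` at `x = cX`) reversed; `c = 1` is
`heckeFrobPoly_card_doubleCosetQuot`. [folklore] -/
theorem heckeFrobPoly_card_doubleCosetQuot_mul_pow (n : ℕ) {M : ℕ} (hM : M ≠ 0)
    {v : HeightOneSpectrum (𝓞 ℚ)} (hv : ¬ v.residueCard ∣ M) (F : Type*) [CommRing F] (c : F) :
    heckeFrobPoly v.residueCard n
        (fun k => ((finite_doubleCosetQuot_finiteLevel n hM (heckeElement n v k)).toFinset.card : F) *
          c ^ k) =
      ∏ j ∈ Finset.range n, (X - C (c * (v.residueCard : F) ^ j)) := by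
  have hsum := sum_ncard_orbit_heckeDiag_mul_pow_eq_prod (n := n)
    (isUniformizingElement_localPrime v) (C c * X : F[X])
  rw [natCard_valuativeResidueField_adicCompletion_eq ℚ v] at hsum
  simp_rw [← card_doubleCosetQuot_heckeElement n hM hv] at hsum
  refine heckeFrobPoly_eq_prod_of_sum_eq ?_
  calc ∑ i ∈ Finset.range (n + 1), C ((-1 : F) ^ i * (v.residueCard : F) ^ (i.choose 2) *
          (((finite_doubleCosetQuot_finiteLevel n hM (heckeElement n v i)).toFinset.card : F) * c ^ i)) *
          X ^ i
      = ∑ i ∈ Finset.range (n + 1), (-1 : F[X]) ^ i * (v.residueCard : F[X]) ^ (i.choose 2) *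
          ((finite_doubleCosetQuot_finiteLevel n hM (heckeElement n v i)).toFinset.card : F[X]) *
            (C c * X) ^ i := Finset.sum_congr rfl fun i _ => by
        simp only [map_mul, map_pow, map_neg, map_one, map_natCast, mul_pow]
        ring
    _ = ∏ i ∈ Finset.range n, (1 - (v.residueCard : F[X]) ^ i * (C c * X)) := hsum
    _ = ∏ i ∈ Finset.range n, (1 - C (c * (v.residueCard : F) ^ i) * X) :=
        Finset.prod_congr rfl fun i _ => by
          simp only [map_mul, map_pow, map_natCast]
          ring

/-! ### The idele `det(1, g)` of `g ∈ GL_n(𝔸_ℚ^∞)` and its ray class modulo `M` -/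

variable {n : ℕ} {M : ℕ} [NeZero M]

/-- The archimedean component of `det (1, g)` (`(1, g) = GLn.ofFinite g ∈ GL_n(𝔸_ℚ)`) is `1`.
[folklore] -/
theorem det_ofFinite_fst (g : GL (Fin n) (FiniteAdeleRing (𝓞 ℚ) ℚ)) :
    ((Matrix.GeneralLinearGroup.det (GLn.ofFinite n ℚ g) : ideleGroup ℚ) :
      NumberField.AdeleRing (𝓞 ℚ) ℚ).1 = 1 := by
  have h1 : (RingHom.fst (NumberField.InfiniteAdeleRing ℚ) (FiniteAdeleRing (𝓞 ℚ) ℚ)).mapMatrix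
      ((GLn.ofFinite n ℚ g : GL (Fin n) (NumberField.AdeleRing (𝓞 ℚ) ℚ)) :
        Matrix (Fin n) (Fin n) (NumberField.AdeleRing (𝓞 ℚ) ℚ)) = 1 := by
    ext i j
    rw [RingHom.mapMatrix_apply, Matrix.map_apply, GLn.coe_ofFinite_apply]
    rfl
  have h := RingHom.map_det (RingHom.fst (NumberField.InfiniteAdeleRing ℚ) (FiniteAdeleRing (𝓞 ℚ) ℚ))
    ((GLn.ofFinite n ℚ g : GL (Fin n) (NumberField.AdeleRing (𝓞 ℚ) ℚ)) :
      Matrix (Fin n) (Fin n) (NumberField.AdeleRing (𝓞 ℚ) ℚ))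
  rw [h1, Matrix.det_one] at h
  rw [Matrix.GeneralLinearGroup.val_det_apply]
  exact h

/-- The finite part of `det (1, g)` is `det g`. [folklore] -/
theorem det_ofFinite_snd (g : GL (Fin n) (FiniteAdeleRing (𝓞 ℚ) ℚ)) :
    ((Matrix.GeneralLinearGroup.det (GLn.ofFinite n ℚ g) : ideleGroup ℚ) :
      NumberField.AdeleRing (𝓞 ℚ) ℚ).2 =
      ((Matrix.GeneralLinearGroup.det g : (FiniteAdeleRing (𝓞 ℚ) ℚ)ˣ) : FiniteAdeleRing (𝓞 ℚ) ℚ) := by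
  have h2 : (RingHom.snd (NumberField.InfiniteAdeleRing ℚ) (FiniteAdeleRing (𝓞 ℚ) ℚ)).mapMatrix
      ((GLn.ofFinite n ℚ g : GL (Fin n) (NumberField.AdeleRing (𝓞 ℚ) ℚ)) :
        Matrix (Fin n) (Fin n) (NumberField.AdeleRing (𝓞 ℚ) ℚ)) =
      ((g : GL (Fin n) (FiniteAdeleRing (𝓞 ℚ) ℚ)) : Matrix (Fin n) (Fin n) (FiniteAdeleRing (𝓞 ℚ) ℚ)) := by
    ext i j
    rw [RingHom.mapMatrix_apply, Matrix.map_apply, GLn.coe_ofFinite_apply]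
    rfl
  have h := RingHom.map_det (RingHom.snd (NumberField.InfiniteAdeleRing ℚ) (FiniteAdeleRing (𝓞 ℚ) ℚ))
    ((GLn.ofFinite n ℚ g : GL (Fin n) (NumberField.AdeleRing (𝓞 ℚ) ℚ)) :
      Matrix (Fin n) (Fin n) (NumberField.AdeleRing (𝓞 ℚ) ℚ))
  rw [h2] at h
  rw [Matrix.GeneralLinearGroup.val_det_apply, Matrix.GeneralLinearGroup.val_det_apply]
  exact h

/-- The `w`-component of `det (1, g)` is `det g_w`. [folklore] -/
theorem det_ofFinite_snd_apply (g : GL (Fin n) (FiniteAdeleRing (𝓞 ℚ) ℚ)) (w : HeightOneSpectrum (𝓞 ℚ)) :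
    ((Matrix.GeneralLinearGroup.det (GLn.ofFinite n ℚ g) : ideleGroup ℚ) :
      NumberField.AdeleRing (𝓞 ℚ) ℚ).2 w =
      ((BigHeckeGLn.localComponent n ℚ w g : GL (Fin n) (w.adicCompletion ℚ)) :
        Matrix (Fin n) (Fin n) (w.adicCompletion ℚ)).det := by
  rw [det_ofFinite_snd, Matrix.GeneralLinearGroup.val_det_apply]
  exact RingHom.map_det (AdelicGroupData.finiteAdeleEval ℚ w) _

/-- `det (1, g)` has infinite component `1 ∈ ℝ`. [folklore] -/
theorem infReal_det_ofFinite (g : GL (Fin n) (FiniteAdeleRing (𝓞 ℚ) ℚ)) :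
    Rat.infReal (Matrix.GeneralLinearGroup.det (GLn.ofFinite n ℚ g)) = 1 := by
  rw [Rat.infReal_apply, det_ofFinite_fst]
  exact map_one (Rat.completionRealEquiv Rat.infinitePlace)

/-- The local idele of `u ∈ ℚ_vˣ` (tree `uniformizerIdele`, a finite idele) is the finite part of the
tree's `localUnits v u ∈ 𝕀_ℚ`. [folklore] -/
theorem coe_uniformizerIdele_eq_localUnits_snd (v : HeightOneSpectrum (𝓞 ℚ))
    (u : (v.adicCompletion ℚ)ˣ) :
    ((uniformizerIdele ℚ v u : (FiniteAdeleRing (𝓞 ℚ) ℚ)ˣ) : FiniteAdeleRing (𝓞 ℚ) ℚ) =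
      ((localUnits v u : ideleGroup ℚ) : NumberField.AdeleRing (𝓞 ℚ) ℚ).2 := by
  refine FiniteAdeleRing.ext ℚ fun w => ?_
  by_cases hw : w = v
  · subst hw
    rw [uniformizerIdele_apply_self, localUnits_snd_apply_self]
  · rw [uniformizerIdele_apply_of_ne ℚ v u hw, localUnits_snd_apply_of_ne u hw]

/-- `Ash2003.localPrime v` is the uniformizer `p_v` of the Hecke-character files
(`Rat.primeLocalUnit`). [folklore] -/
theorem localPrime_eq_primeLocalUnit (v : HeightOneSpectrum (𝓞 ℚ)) :
    localPrime v = Rat.primeLocalUnit v := by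
  refine Units.ext ?_
  rw [coe_localPrime, Rat.primeLocalUnit, Units.val_mk0, map_natCast, Rat.residueCard_eq_natGenerator v]

/-- `|(r)|_v = |r|_v`: the radius of a principal ideal is the valuation of its generator.
[folklore] -/
theorem idealRadius_span_singleton_eq_intValuation {K : Type} [Field K] [NumberField K]
    (v : HeightOneSpectrum (𝓞 K)) {r : 𝓞 K} (hr : r ≠ 0) :
    idealRadius K v (Ideal.span {r}) = v.intValuation r := by
  have h0 : Ideal.span {r} ≠ 0 := by
    rwa [Ne, Ideal.zero_eq_bot, Ideal.span_singleton_eq_bot]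
  rw [idealRadius, FractionalIdeal.count_coe K v h0, v.intValuation_if_neg hr]

/-- `|(M)|_v ≤ q_v^{-e}` for `q_v^e ‖ M`: the radius of the level ideal `(M)` at `v` is at most
`exp(-ord_{q_v} M)`. [folklore] -/
theorem idealRadius_span_natCast_le {M : ℕ} (hM : M ≠ 0) (v : HeightOneSpectrum (𝓞 ℚ)) :
    idealRadius ℚ v (Ideal.span {(M : 𝓞 ℚ)}) ≤
      WithZero.exp (-(M.factorization (Rat.HeightOneSpectrum.natGenerator v) : ℤ)) := by
  have hM0 : (M : 𝓞 ℚ) ≠ 0 := by exact_mod_cast hM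
  rw [idealRadius_span_singleton_eq_intValuation v hM0, HeightOneSpectrum.intValuation_le_pow_iff_mem]
  set q := Rat.HeightOneSpectrum.natGenerator v with hq
  obtain ⟨M', hM'⟩ : q ^ M.factorization q ∣ M := Nat.ordProj_dvd M q
  have hmem : ((q ^ M.factorization q * M' : ℕ) : 𝓞 ℚ) ∈ v.asIdeal ^ M.factorization q := by
    rw [Nat.cast_mul, Nat.cast_pow]
    exact Ideal.mul_mem_right _ _
      (Ideal.pow_mem_pow ((Rat.natCast_mem_asIdeal_iff v).2 (dvd_refl q)) _)
  rwa [← hM'] at hmem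

/-- **`det K_f(M)` is killed by the ray class map mod `M`**: for `g ∈ K_f(M)` the idele `det (1, g)`
lies in `ℝ_{>0} × ∏_l ℤ_l^×` with `det g_l ≡ 1 (mod l^{ord_l M})` at `l ∣ M` (`valued_det_sub_one_le`),
so `Rat.rayClassHom M` (the map `𝕀_ℚ → (ℤ/M)^×` of [NeukirchANT1999, Ch. VI Prop. (1.10)]) sends it
to `1`. [folklore] -/
theorem rayClassHom_det_ofFinite_eq_one {g : GL (Fin n) (FiniteAdeleRing (𝓞 ℚ) ℚ)}
    (hg : g ∈ finiteLevel n M) :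
    Rat.rayClassHom M (Matrix.GeneralLinearGroup.det (GLn.ofFinite n ℚ g)) = 1 := by
  have hM : M ≠ 0 := NeZero.ne M
  have hint : g ∈ glFiniteIntegralLevel n ℚ := comap_ofFinite_principalCongruenceLevel_le n ℚ _ hg
  have hloc : ∀ w, BigHeckeGLn.localComponent n ℚ w g ∈
      valuedCongruenceSubgroup (Fin n) (1 : WithZero (Multiplicative ℤ)) := fun w =>
    BigHeckeGLn.localComponent_mem_valuedCongruenceSubgroup_one hint w
  have hval : ∀ w, Valued.v (((Matrix.GeneralLinearGroup.det (GLn.ofFinite n ℚ g) : ideleGroup ℚ) :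
      NumberField.AdeleRing (𝓞 ℚ) ℚ).2 w) = 1 := fun w => by
    rw [det_ofFinite_snd_apply, ← Matrix.GeneralLinearGroup.val_det_apply]
    exact valued_det_eq_one (hloc w).1 (hloc w).2.1
  have hinf : 0 < Rat.infReal (Matrix.GeneralLinearGroup.det (GLn.ofFinite n ℚ g)) := by
    rw [infReal_det_ofFinite]; exact one_pos
  rw [Rat.rayClassHom_eq_redMod M _ hinf hval]
  refine Rat.redMod_eq_one_of_valued M hval fun q => ?_
  rw [det_ofFinite_snd_apply]
  have hlev := (mem_principalCongruenceLevel_iff.1 (mem_finiteLevel_iff.1 hg)).2 (Rat.placeOfFactor M q)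
  rw [toLocal_ofFinite] at hlev
  obtain ⟨h₁, -, h₃⟩ := hlev
  refine valued_det_sub_one_le h₁ fun i j => (h₃ i j).trans ?_
  have h := idealRadius_span_natCast_le hM (Rat.placeOfFactor M q)
  rwa [Rat.natGenerator_placeOfFactor M q] at h

/-- **`det GL_n(ℚ)⁺` is killed by the ray class map**: for `γ` of positive rational determinant `d`,
`det (1, γ) = (1, d) = (d, d) · (d⁻¹, 1) ∈ ℚ^× · ℝ_{>0}`. [folklore] -/
theorem rayClassHom_det_ofFinite_toFiniteAdelic (γ : Matrix.GLPos (Fin n) ℚ) :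
    Rat.rayClassHom M (Matrix.GeneralLinearGroup.det
      (GLn.ofFinite n ℚ (toFiniteAdelic n (γ : GL (Fin n) ℚ)))) = 1 := by
  set d : ℚˣ := Matrix.GeneralLinearGroup.det (γ : GL (Fin n) ℚ) with hd
  have hdpos : (0 : ℚ) < d := (Matrix.mem_glpos _).1 γ.2
  have hdet : ((Matrix.GeneralLinearGroup.det (toFiniteAdelic n (γ : GL (Fin n) ℚ)) :
      (FiniteAdeleRing (𝓞 ℚ) ℚ)ˣ) : FiniteAdeleRing (𝓞 ℚ) ℚ) =
      algebraMap ℚ (FiniteAdeleRing (𝓞 ℚ) ℚ) (d : ℚ) := by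
    rw [hd, Matrix.GeneralLinearGroup.val_det_apply, Matrix.GeneralLinearGroup.val_det_apply]
    exact (RingHom.map_det (algebraMap ℚ (FiniteAdeleRing (𝓞 ℚ) ℚ)) _).symm
  set x : ideleGroup ℚ := Matrix.GeneralLinearGroup.det
    (GLn.ofFinite n ℚ (toFiniteAdelic n (γ : GL (Fin n) ℚ))) with hx
  set z : ideleGroup ℚ := x * (GaloisRepresentations.principalIdele ℚ d)⁻¹ with hz
  have hx2 : ∀ w, ((x : ideleGroup ℚ) : NumberField.AdeleRing (𝓞 ℚ) ℚ).2 w =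
      ((GaloisRepresentations.principalIdele ℚ d : ideleGroup ℚ) :
        NumberField.AdeleRing (𝓞 ℚ) ℚ).2 w := by
    intro w
    rw [hx, det_ofFinite_snd, hdet]
    rfl
  have hz2 : ∀ w, ((z : ideleGroup ℚ) : NumberField.AdeleRing (𝓞 ℚ) ℚ).2 w = 1 := by
    intro w
    rw [hz]
    change ((x : ideleGroup ℚ) : NumberField.AdeleRing (𝓞 ℚ) ℚ).2 w *
      (((GaloisRepresentations.principalIdele ℚ d)⁻¹ : ideleGroup ℚ) :
        NumberField.AdeleRing (𝓞 ℚ) ℚ).2 w = 1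
    rw [hx2, ← map_inv, principalIdele_snd, principalIdele_snd, ← map_mul, Units.mul_inv, map_one]
  have hinf : 0 < Rat.infReal z := by
    rw [hz, map_mul, map_inv, Rat.infReal_principalIdele, hx, infReal_det_ofFinite, one_mul, inv_pos]
    exact_mod_cast hdpos
  have hval : ∀ w, Valued.v (((z : ideleGroup ℚ) : NumberField.AdeleRing (𝓞 ℚ) ℚ).2 w) = 1 :=
    fun w => by rw [hz2]; exact map_one _
  have hxz : x = z * GaloisRepresentations.principalIdele ℚ d := by rw [hz, inv_mul_cancel_right]
  rw [hxz, map_mul, Rat.rayClassHom_principalIdele, mul_one, Rat.rayClassHom_eq_redMod M z hinf hval]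
  exact Rat.redMod_eq_one_of_snd_eq_one M fun q => hz2 _

/-- `det (1, s_{l,k}) = ⟨l⟩_l^k`: the determinant of the Hecke element is the `k`-th power of the local
idele of `l` at `v` (`k ≤ n`; tree `localUnits`). [folklore] -/
theorem det_ofFinite_heckeElement (v : HeightOneSpectrum (𝓞 ℚ)) {k : ℕ} (hk : k ≤ n) :
    Matrix.GeneralLinearGroup.det (GLn.ofFinite n ℚ (heckeElement n v k)) =
      localUnits v (localPrime v) ^ k := by
  refine Units.ext ?_
  rw [Matrix.GeneralLinearGroup.val_det_apply, Units.val_pow_eq_pow_val]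
  have hdiag : ((GLn.ofFinite n ℚ (heckeElement n v k) : GL (Fin n) (NumberField.AdeleRing (𝓞 ℚ) ℚ)) :
      Matrix (Fin n) (Fin n) (NumberField.AdeleRing (𝓞 ℚ) ℚ)) =
      Matrix.diagonal fun j : Fin n =>
        if j.val < k then ((localUnits v (localPrime v) : ideleGroup ℚ) : NumberField.AdeleRing (𝓞 ℚ) ℚ)
        else 1 := by
    ext i j : 1
    rw [GLn.coe_ofFinite_apply, heckeElement, coe_glDiagonal, Matrix.diagonal_apply, Matrix.diagonal_apply,
      Matrix.one_apply]
    by_cases hij : i = j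
    · subst hij
      rw [if_pos rfl, if_pos rfl, if_pos rfl]
      by_cases hik : i.val < k
      · rw [if_pos hik, if_pos hik]
        exact Prod.ext rfl (coe_uniformizerIdele_eq_localUnits_snd v (localPrime v))
      · rw [if_neg hik, if_neg hik]
        rfl
    · rw [if_neg hij, if_neg hij, if_neg hij]
      rfl
  rw [hdiag, Matrix.det_diagonal]
  obtain ⟨m, rfl⟩ := Nat.exists_eq_add_of_le hk
  rw [Fin.prod_univ_eq_prod_range (fun i => if i < k then
      ((localUnits v (localPrime v) : ideleGroup ℚ) : NumberField.AdeleRing (𝓞 ℚ) ℚ) else 1) (k + m),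
    Finset.prod_range_add, Finset.prod_congr rfl fun i hi => by rw [if_pos (Finset.mem_range.1 hi)],
    Finset.prod_const, Finset.card_range, Finset.prod_eq_one fun i _ => by rw [if_neg (by omega)], mul_one]

/-- **The ray class of `det (1, s_{l,k})`** (`l = q_v ∤ M`, `k ≤ n`): `(l mod M)^{-k}`
(`Rat.rayClassHom_localUnits_primeLocalUnit`: the uniformizer idele at `l` maps to `(l mod M)⁻¹`).
[folklore] -/
theorem rayClassHom_det_ofFinite_heckeElement {v : HeightOneSpectrum (𝓞 ℚ)}
    (hv : ¬ v.residueCard ∣ M) {k : ℕ} (hk : k ≤ n) :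
    Rat.rayClassHom M (Matrix.GeneralLinearGroup.det (GLn.ofFinite n ℚ (heckeElement n v k))) =
      (ZMod.unitOfCoprime v.residueCard
        ((Nat.Prime.coprime_iff_not_dvd (residueCard_prime v)).2 hv))⁻¹ ^ k := by
  have hv' : ¬ Rat.HeightOneSpectrum.natGenerator v ∣ M := by
    rwa [← Rat.residueCard_eq_natGenerator v]
  rw [det_ofFinite_heckeElement v hk, map_pow, localPrime_eq_primeLocalUnit,
    Rat.rayClassHom_localUnits_primeLocalUnit M hv']
  congr 2
  refine Units.ext ?_
  rw [ZMod.coe_unitOfCoprime, ZMod.coe_unitOfCoprime, Rat.residueCard_eq_natGenerator v]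

/-! ### The degree-`0` eigenclasses `η(det) ∈ H⁰(X(M), F)` -/

/-- **The eigenclass `[η ∘ det] ∈ H⁰(X(M), F)`** (`M ≠ 0`, `η : (ℤ/M)^× → F^×`): the function
`g ↦ η(det (1,g) mod M)` — the **determinant character** `η ∘ Rat.rayClassHom M ∘ det ∘ GLn.ofFinite`
of `GL_n(𝔸_ℚ^∞)`, `det (1, g)` reduced by the ray class map `𝕀_ℚ → (ℤ/M)^×` of
[NeukirchANT1999, Ch. VI Prop. (1.10)] — is trivial on `K_f(M)` (`rayClassHom_det_ofFinite_eq_one`)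
and on `GL_n(ℚ)⁺` (`rayClassHom_det_ofFinite_toFiniteAdelic`), hence a function on the component
set `GL_n(ℚ)⁺ \ GL_n(𝔸_ℚ^∞) / K_f(M)`; its class in `H⁰` is a nonzero Hecke eigenclass with
`T_{l,k}`-eigenvalue `#(K_f(M) s_{l,k} K_f(M)/K_f(M)) · η(l mod M)^{-k}` at `l ∤ M`, `k ≤ n`
(`heckeFun_charFun`, `rayClassHom_det_ofFinite_heckeElement`).  The values of the eigenvalue
system at `l ∣ M` (set to `0`) are not constrained by `IsEigenclass`.
[cite: Ash2003, §2 and Def. 0.1] -/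
theorem exists_isEigenclass_zero_detCharacter (n : ℕ) {M : ℕ} (hM : M ≠ 0) (F : Type) [Field F]
    (η : (ZMod M)ˣ →* Fˣ) :
    ∃ α : cohomology n M F 0,
      IsEigenclass n M F 0 α fun v k =>
        ((finite_doubleCosetQuot_finiteLevel n hM (heckeElement n v k)).toFinset.card : F) *
          (if hv : ¬ v.residueCard ∣ M then
            ((η (ZMod.unitOfCoprime v.residueCard
              ((Nat.Prime.coprime_iff_not_dvd (residueCard_prime v)).2 hv))⁻¹ : Fˣ) : F) ^ k
          else 0) := by
  haveI : NeZero M := ⟨hM⟩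
  -- the determinant character `φ = η ∘ rayClassHom ∘ det ∘ (1, ·)`
  set φ : GL (Fin n) (FiniteAdeleRing (𝓞 ℚ) ℚ) →* Fˣ :=
    η.comp ((Rat.rayClassHom M).comp (Matrix.GeneralLinearGroup.det.comp (GLn.ofFinite n ℚ))) with hφ
  have hφapply : ∀ g, φ g = η (Rat.rayClassHom M (Matrix.GeneralLinearGroup.det (GLn.ofFinite n ℚ g))) :=
    fun g => rfl
  have hL : ∀ l ∈ finiteLevel n M, φ l = 1 := fun l hl => by
    rw [hφapply, rayClassHom_det_ofFinite_eq_one hl, map_one]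
  have hΓ : ∀ γ, φ (posDetToFiniteAdelic n γ) = 1 := fun γ => by
    rw [hφapply, posDetToFiniteAdelic_apply, rayClassHom_det_ofFinite_toFiniteAdelic, map_one]
  let f : (ArithmeticQuotient.coeffRepresentation F (posDetToFiniteAdelic n) (finiteLevel n M)
      F).invariants :=
    ⟨fun c : _ ⧸ finiteLevel n M => ((φ c.out : Fˣ) : F),
      ArithmeticQuotient.charFun_mem_invariants F (posDetToFiniteAdelic n) hL hΓ⟩
  refine ⟨(groupCohomology.H0Iso (ArithmeticQuotient.coeffRep F (posDetToFiniteAdelic n)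
      (finiteLevel n M) F)).inv f, ?_, fun v hv k hk => ?_⟩
  · refine ArithmeticQuotient.H0Iso_inv_ne_zero_of_apply_ne_zero F (posDetToFiniteAdelic n)
      (finiteLevel n M) f
      (c := ((1 : GL (Fin n) (FiniteAdeleRing (𝓞 ℚ) ℚ)) : _ ⧸ finiteLevel n M)) ?_
    change ((φ ((1 : GL (Fin n) (FiniteAdeleRing (𝓞 ℚ) ℚ)) : _ ⧸ finiteLevel n M).out : Fˣ) : F) ≠ 0
    rw [ArithmeticQuotient.charFun_mk F hL, map_one, Units.val_one]
    exact one_ne_zero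
  · beta_reduce
    rw [dif_pos hv]
    have hval : φ (heckeElement n v k) = η (ZMod.unitOfCoprime v.residueCard
        ((Nat.Prime.coprime_iff_not_dvd (residueCard_prime v)).2 hv))⁻¹ ^ k := by
      rw [hφapply, rayClassHom_det_ofFinite_heckeElement hv hk, map_pow]
    have h := ArithmeticQuotient.heckeFun_charFun F hL
      (finite_doubleCosetQuot_finiteLevel n hM (heckeElement n v k))
    rw [hval, Units.val_pow_eq_pow_val] at h
    exact ArithmeticQuotient.heckeEnd_H0Iso_inv_eq_smul F (posDetToFiniteAdelic n) (finiteLevel n M)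
      f h

/-! ### Theorem 1.1 for the characters `θ = χ ∘ N_{L/ℚ}` -/

/-- **[Ash2003, Thm. 1.1 / Cor. 4.4] for the ray class characters factoring through the norm.**
Let `p` be a prime, `N ≥ 1`, `F` a field of characteristic `p` (with any topology), `χ` a Dirichlet
character modulo `pN` with values in `F`, `θ` a character of the ray class group of `L = ℚ(ζ_p)`
modulo `(pN)` with `θ([w]) = χ(N w)` for every prime `w ∤ pN` of `L` (that is, `θ = χ ∘ N_{L/ℚ}`),
and `ϑ : Γ_L → F^×` a Galois avatar of `θ`.  Then there are a degree `i` (`= 0`), a Hecke eigenclass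
`α ∈ H^i(X(pN), F)` with eigenvalues `a` and `Ind_{Γ_L}^{Γ_ℚ} ϑ` attached to `a`: `α = [χ⁻¹(det)]`
(`exists_isEigenclass_zero_detCharacter`), `a(l,k) = #(K_f s_{l,k} K_f / K_f) · χ(l)^k`, whose
Hecke–Frobenius polynomial `∏_{j<p-1} (X - χ(l) l^j)` (`heckeFrobPoly_card_doubleCosetQuot_mul_pow`) is
`det(X - Ind(ϑ)(Frob_l))` (`hasFrobCharpolyAt_induce_of_isGaloisAvatar_of_norm`).  These `θ` are
exactly the characters for which [Ash2003]'s eigenclass lives in degree `0`; the remaining `θ`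
require the Smith-theory argument of the paper. [cite: Ash2003, Thm. 1.1 and Cor. 4.4] -/
theorem exists_isEigenclass_isAttached_of_isGaloisAvatar_of_norm (p : ℕ) [hp : Fact p.Prime]
    {N : ℕ} (hN : N ≠ 0) (F : Type) [Field F] [Algebra (ZMod p) F] [TopologicalSpace F]
    (χ : MulChar (ZMod (p * N)) F)
    (θ : RayClassGroup (modulus (CyclotomicField p ℚ) (p * N)) →* Fˣ)
    (hθ : ∀ (w : HeightOneSpectrum (𝓞 (CyclotomicField p ℚ)))
      (hw : IsCoprime w.asIdeal (modulus (CyclotomicField p ℚ) (p * N))),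
      ((θ (integralRayClass (modulus (CyclotomicField p ℚ) (p * N))
        (modulus_ne_bot (CyclotomicField p ℚ) (mul_ne_zero (Nat.Prime.ne_zero hp.out) hN))
        ⟨w.asIdeal, w.ne_bot, hw⟩) : Fˣ) : F) = χ (w.residueCard : ZMod (p * N)))
    (ϑ : FramedGaloisRep (CyclotomicField p ℚ) F 1)
    (hϑ : IsGaloisAvatar
      (modulus_ne_bot (CyclotomicField p ℚ) (mul_ne_zero (Nat.Prime.ne_zero hp.out) hN)) θ ϑ) :
    ∃ (i : ℕ) (α : cohomology (p - 1) (p * N) F i) (a : HeightOneSpectrum (𝓞 ℚ) → ℕ → F),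
      IsEigenclass (p - 1) (p * N) F i α a ∧
        IsAttached p (p * N) (FramedGaloisRep.induce ℚ (finrank_cyclotomicField p) ϑ) a := by
  have hM : p * N ≠ 0 := mul_ne_zero hp.out.ne_zero hN
  haveI : NeZero (p * N) := ⟨hM⟩
  obtain ⟨α, hα⟩ := exists_isEigenclass_zero_detCharacter (p - 1) hM F (MulChar.toUnitHom χ)⁻¹
  refine ⟨0, α, _, hα, fun v hv => ⟨isUnramifiedAt_induce_of_isGaloisAvatar p hN θ ϑ hϑ hv, ?_⟩⟩
  have hv' : ¬ v.residueCard ∣ p * N := fun h => hv (h.trans (Dvd.intro_left p rfl))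
  have hc : ((((MulChar.toUnitHom χ)⁻¹ : (ZMod (p * N))ˣ →* Fˣ) (ZMod.unitOfCoprime v.residueCard
      ((Nat.Prime.coprime_iff_not_dvd (residueCard_prime v)).2 hv'))⁻¹ : Fˣ) : F) =
      χ (v.residueCard : ZMod (p * N)) := by
    rw [MonoidHom.inv_apply, map_inv, inv_inv, MulChar.coe_toUnitHom, ZMod.coe_unitOfCoprime]
  have e : heckeFrobPoly v.residueCard ((p - 1) * 1)
      (fun k => ((finite_doubleCosetQuot_finiteLevel (p - 1) hM
        (heckeElement (p - 1) v k)).toFinset.card : F) *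
        (if hv : ¬ v.residueCard ∣ p * N then
          ((((MulChar.toUnitHom χ)⁻¹ : (ZMod (p * N))ˣ →* Fˣ) (ZMod.unitOfCoprime v.residueCard
            ((Nat.Prime.coprime_iff_not_dvd (residueCard_prime v)).2 hv))⁻¹ : Fˣ) : F) ^ k
        else 0)) =
      ∏ j ∈ Finset.range (p - 1),
        (X - C (χ (v.residueCard : ZMod (p * N)) * (v.residueCard : F) ^ j)) := by
    rw [mul_one]
    simp_rw [dif_pos hv', hc]
    exact heckeFrobPoly_card_doubleCosetQuot_mul_pow (p - 1) hM hv' F _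
  rw [e]
  exact hasFrobCharpolyAt_induce_of_isGaloisAvatar_of_norm p hN χ θ hθ ϑ hϑ hv

end Ash2003

end Literature.NumberTheory.Automorphic
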